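import Summits.CriticalPhenomena.PercolationContinuityZ3.Theorems.Transplant.SkelPhiExcess
import Summits.CriticalPhenomena.PercolationContinuityZ3.Theorems.Transplant.SkelConcExcessIn
import HarnessLib

/-!
# D″ node, STRUCTURE-FREE generic layer (SHEAR-SCOPE §3.14 ruling (B″), V98; DPRIME-SCOPE L4′/L6′, hp-8 d1): the EXCESS DISCHARGE over the
# window graphs of a bare planar map `φ : V → ℤ²` — the rim excess of a subbox weighting of `Skel.winGraph G w₁ Rπ` / `Skel.winGraphIn G Ω`
# from an excess radius at the running parameter, the excess radius made UNIFORM IN THE CENTRE (degree bound (μ) as the explicit hypothesis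
# `hΔ : ∀ v, G.degree v ≤ Δ`), and the rim excess of a chain from a WIRED source set — φ-level re-cut of the Φ-DEPENDENT declarations of
# `SkelConcExcess` §2 (hp-8 g22, p232268) ∪ `SkelConcExcessIn` §2 (p5-g4); their Φ-FREE §1 (`Skel.real_excess_eq(_In)`,
# `Skel.real_rim_le_excess(_In)`) is IMPORTED, not re-declared

builds on p205010 (kernel theorem, internal audit signed; external expert review pending) — nothing in this file uses p205010.
Lane `prim-bschramm`, seat `prim-hp-8` (gen 30; V98 hp-8 column d1, p3-g7 rulings 2026-08-21T03:54:39Z (1) / 04:07:10Z (1)); helper file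
(`--supports stmt-CriticalPhenomena-4575`).  Hypotheses through p3-g7's dictionary (DPRIME-SCOPE addendum K): `hfr : Skelφ.Frames G φ types`
and Φ2 `hC : Skelφ.CylSubcritical G φ types p` (through `Skelφ.exists_selfExit_radius`), `hΔ : ∀ v, G.degree v ≤ Δ` (the entrance count
`|B_G(c, ρ)| ≤ (Δ+1)^ρ`) — only in `exists_excess_radius_uniform`; the three discharges take the radius in the `hR₁` shape and no hypothesis.
Instance regime (K2.4): the subbox hypotheses `IsSubbox (winGraph …) Wt q D` are stated at the consumer's `[DecidableEq V]` (as in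
`Skelφ.lhyp_win`), the bridge to the classically stated Φ-free §1 lemmas is done ONCE here (`convert`), so φ-level consumers pass `hWD` as is.
* §1 **`real_rim_le_of_radius`** — `P_{Wt}(⋃_{t ∈ Rim} root ↔ t) ≤ η` for a subbox `Wt` of `winGraph G w₁ Rπ` on `D ⊆ B_G(w₁, Rπ)`, `root ∉ D`,
  `Rim ⊆ D` beyond depth `R − L'` from `w₀`, positive-weight entrances at depth `≤ R₀'`, an excess radius `R₁ ≤ R − L'` (shape `hR₁`), the habitat
  inside `B_G(w₀, R_w)` of planar diameter `≤ m`;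
* **`exists_excess_radius_uniform (hfr) (hC) (hΔ)`** — ONE radius for ALL centres: `∃ R₁, ∀ c, ∀ R ≥ R₁, ∀ Rw D A, … ⇒ P_p(excess c R D A) ≤ η`;
* **`real_rim_le_of_wired_source`** — the rim excess of a chain from a wired source set `S` under the law cut to its world `Qt`;
* §2 **`real_rim_le_of_radius_In`** — §1's first discharge for a subbox of the habitat-restricted window graph `winGraphIn G Ω`, `D ⊆ Ω`.
Call sites port from `Skel.*` by `Φ ↦ ` (nothing) for the discharges and `Φ hC ↦ hfr hC hΔ` for the uniform radius (K2.2).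
[cite: KozmaNitzan2024, §4 Lemma 12 (p. 24: the faces on the boundary of the slab), Lemma 11 (p. 22)] [cite: MartineauSevero2019, Cor. 2.2]
-/

noncomputable section

open MeasureTheory

namespace Summit.CriticalPhenomena.PercolationContinuityZ3.Theorems.Transplant

namespace Skelφ

open Literature.Probability.Percolation Literature.Probability.LatticeModels SimpleGraph KNLevels
open Literature.Probability.Percolation.GM
open Literature.Barriers.CriticalPhenomena (graphBall graphBall_finite mem_graphBall_self graphBall_mono)
open KozmaNitzan (wireSet_mono)
open Skel (excess winGraph winGraphIn)

open scoped Classical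

variable {V : Type} {G : SimpleGraph V} [G.LocallyFinite] {φ : V → Site 2}

/-! ## §1 The discharges over the window graph `winGraph G w₁ Rπ`; the excess radius uniform in the centre -/

/-- **Rim excess ≤ η** from an excess radius at the running parameter: with `hR₁` the conclusion of `Skelφ.exists_excess_radius hfr hC w₀ R₀' m hη`
(or of `exists_excess_radius_uniform` at the centre `w₀`) at `q`, `R₁ ≤ R − L'`, the habitat inside `B_G(w₀, R_w)` and of planar diameter `≤ m`
(φ-level form of `Skel.real_rim_le_of_radius`; the subbox hypothesis at the ambient `DecidableEq`).
[cite: KozmaNitzan2024, §4 Lemma 12 (p. 24)] [cite: MartineauSevero2019, Cor. 2.2] -/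
theorem real_rim_le_of_radius [DecidableEq V] [Countable V] {w₁ : V} {Rπ : ℕ} {Wt : Sym2 V → unitInterval} {q : unitInterval} {D : Finset V}
    (hWD : IsSubbox (winGraph G w₁ Rπ) Wt q D) (hDπ : ∀ v ∈ D, v ∈ graphBall G w₁ Rπ) (hWG : ∀ e, e ∉ G.edgeSet → Wt e = 0)
    {root : V} (hroot : root ∉ D) {w₀ : V} {R L' R₀' : ℕ} {Rim : Finset V} (hRimD : Rim ⊆ D)
    (hRimfar : ∀ t ∈ Rim, t ∉ graphBall G w₀ (R - L'))
    (hA : ∀ a b, a ∉ D → b ∈ D → G.Adj a b → Wt s(a, b) ≠ 0 → b ∈ graphBall G w₀ R₀')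
    {m : ℕ} {η : ℝ} {R₁ : ℕ}
    (hR₁ : ∀ R', R₁ ≤ R' → ∀ (Rw : ℕ) (D' A' : Finset V), (∀ d ∈ D', d ∈ graphBall G w₀ Rw) →
      (∀ d ∈ D', ∀ d' ∈ D', φ d - φ d' ∈ box 2 m) → A' ⊆ D' → (∀ a ∈ A', a ∈ graphBall G w₀ R₀') →
        (bondPercolation G q).real (excess G w₀ R' D' A') ≤ η)
    (hR : R₁ ≤ R - L') {Rw : ℕ} (hDw : ∀ d ∈ D, d ∈ graphBall G w₀ Rw) (hDm : ∀ d ∈ D, ∀ d' ∈ D, φ d - φ d' ∈ box 2 m) :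
    (prodBernoulli Wt).real (⋃ t ∈ Rim, openConn root t) ≤ η := by
  -- the Φ-free `Skel.real_rim_le_excess` is stated with the classical `DecidableEq`; bridge by subsingleton-ness of instances
  have hWD' : @KNLevels.IsSubbox V (fun a b => Classical.propDecidable (a = b)) (winGraph G w₁ Rπ) _ Wt q D := by convert hWD
  refine (Skel.real_rim_le_excess G hWD' hDπ hWG hroot hRimD hRimfar hA).trans ?_
  exact hR₁ _ hR Rw D _ hDw hDm (Finset.filter_subset _ _) fun a ha => (Finset.mem_filter.1 ha).2

/-- **One excess radius for all habitats AND ALL CENTRES**: under `Frames` and Φ2 at `p` and the degree bound `Δ`, for `η > 0`, an entrance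
depth `ρ` and a planar scale `m` there is `R₁` such that for EVERY centre `c`, every `R ≥ R₁`, every habitat `D ⊆ B_G(c, R_w)` of planar diameter
`≤ m` and every entrance set `A ⊆ D ∩ B_G(c, ρ)`, `P_p(excess c R D A) ≤ η` — the number of possible entrances is `≤ (Δ + 1)^ρ` whatever the
centre, and the self-exit radius of `Skelφ.exists_selfExit_radius` is already uniform over all vertices (frames) (φ-level form of
`Skel.exists_excess_radius_uniform`). [cite: KozmaNitzan2024, §4 Lemma 12 (p. 24)] [cite: MartineauSevero2019, Cor. 2.2] -/
theorem exists_excess_radius_uniform [Countable V] {types : Finset V} (hfr : Frames G φ types) {p : unitInterval}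
    (hC : CylSubcritical G φ types p) {Δ : ℕ} (hΔ : ∀ v, G.degree v ≤ Δ) (ρ m : ℕ) {η : ℝ} (hη : 0 < η) :
    ∃ R₁ : ℕ, ∀ (c : V) (R : ℕ), R₁ ≤ R → ∀ (Rw : ℕ) (D A : Finset V), (∀ d ∈ D, d ∈ graphBall G c Rw) →
      (∀ d ∈ D, ∀ d' ∈ D, φ d - φ d' ∈ box 2 m) → A ⊆ D → (∀ a ∈ A, a ∈ graphBall G c ρ) →
        (bondPercolation G p).real (excess G c R D A) ≤ η := by
  classical
  set μ := bondPercolation G p with hμ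
  -- the number of possible entrances, uniformly in the centre
  set N : ℕ := (Δ + 1) ^ ρ with hN
  have hε : 0 < η / (N + 1) := by positivity
  obtain ⟨R₀, hR₀⟩ := exists_selfExit_radius hfr hC m hε
  refine ⟨ρ + R₀, fun c R hR Rw D A hDw hDm hAD hA => ?_⟩
  have hρ : ρ ≤ R := by omega
  have hcardA : A.card ≤ N := by
    calc A.card ≤ (BoxProdZ2.ballFin G c ρ).card := Finset.card_le_card fun a ha => (BoxProdZ2.mem_ballFin G).2 (hA a ha)
      _ ≤ N := BoxProdZ2.card_ballFin_le G hΔ c ρ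
  calc μ.real (excess G c R D A) ≤ μ.real (⋃ a ∈ A, selfExit G φ m (R - ρ) a) :=
        measureReal_mono (excess_subset_biUnion_selfExit hDw hDm hAD hA hρ) (measure_ne_top _ _)
    _ ≤ ∑ a ∈ A, μ.real (selfExit G φ m (R - ρ) a) := measureReal_biUnion_finset_le _ _
    _ ≤ ∑ a ∈ A, η / (N + 1) := Finset.sum_le_sum fun a _ => hR₀ _ (by omega) a
    _ = A.card * (η / (N + 1)) := by rw [Finset.sum_const, nsmul_eq_mul]
    _ ≤ N * (η / (N + 1)) := by gcongr
    _ ≤ η := by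
        rw [mul_div_assoc']
        refine (div_le_iff₀ (by positivity)).2 ?_
        nlinarith

/-- **Rim excess from a wired source set.**  For a subbox `Qt` of `Wt` in the window graph `winGraph G w₁ R_π` (`Qt ⊆ B_G(w₁, R_π)`), a
source set `S ⊆ Qt` at depth `≤ R₀'` from the centre `c`, a point `o ∈ S`, a rim `Rim ⊆ Qt` disjoint from `S` beyond depth `r₁` from `c`,
a centre-uniform excess radius `R₁ ≤ r₁` at the running parameter (the conclusion of `exists_excess_radius_uniform`), and `Qt ⊆ B_G(c, R_w)` of
planar diameter `≤ m`: under the law cut to `Qt` with any pinning of pairs inside `S`, `P(⋃_{t ∈ Rim} o ↔ t) ≤ η` (φ-level form of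
`Skel.real_rim_le_of_wired_source`; the subbox hypothesis at the ambient `DecidableEq`).
[cite: KozmaNitzan2024, §4 Lemma 11 (p. 22), Lemma 12 (p. 24)] [cite: MartineauSevero2019, Cor. 2.2] -/
theorem real_rim_le_of_wired_source [DecidableEq V] [Countable V] {w₁ : V} {Rπ : ℕ} {Wt : Sym2 V → unitInterval} {q : unitInterval}
    {Qt : Finset V} (hWQ : IsSubbox (winGraph G w₁ Rπ) Wt q Qt) (hQπ : ∀ v ∈ Qt, v ∈ graphBall G w₁ Rπ)
    {S Rim : Finset V} (hSQ : S ⊆ Qt) (hRimQ : Rim ⊆ Qt) (hSR : Disjoint S Rim) {o : V} (ho : o ∈ S)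
    {c : V} {r₁ R₀' : ℕ} (hfar : ∀ t ∈ Rim, t ∉ graphBall G c r₁) (hnear : ∀ s ∈ S, s ∈ graphBall G c R₀')
    {m : ℕ} {η : ℝ} {R₁ : ℕ}
    (hR₁ : ∀ (c' : V) (R' : ℕ), R₁ ≤ R' → ∀ (Rw : ℕ) (D' A' : Finset V), (∀ d ∈ D', d ∈ graphBall G c' Rw) →
      (∀ d ∈ D', ∀ d' ∈ D', φ d - φ d' ∈ box 2 m) → A' ⊆ D' → (∀ a ∈ A', a ∈ graphBall G c' R₀') →
        (bondPercolation G q).real (excess G c' R' D' A') ≤ η)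
    (hR : R₁ ≤ r₁) {Rw : ℕ} (hQw : ∀ d ∈ Qt, d ∈ graphBall G c Rw) (hQm : ∀ d ∈ Qt, ∀ d' ∈ Qt, φ d - φ d' ∈ box 2 m)
    {F₀ : Set (Sym2 V)} (hF₀ : F₀ ⊆ wireSet (↑S : Set V)) (pat : Set (Sym2 V)) :
    (prodBernoulli (restrW (↑Qt : Set V) (pinW Wt F₀ pat))).real (⋃ t ∈ Rim, openConn o t) ≤ η := by
  -- the Φ-free `Skel.real_excess_eq` is stated with the classical `DecidableEq`; bridge by subsingleton-ness of instances
  have hWQ' : @KNLevels.IsSubbox V (fun a b => Classical.propDecidable (a = b)) (winGraph G w₁ Rπ) _ Wt q Qt := by convert hWQ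
  -- under the cut law open paths stay inside `Qt`
  have h1 : (prodBernoulli (restrW (↑Qt : Set V) (pinW Wt F₀ pat))).real (⋃ t ∈ Rim, openConn o t) =
      (prodBernoulli (pinW Wt F₀ pat)).real (⋃ t ∈ (↑Rim : Set V), openConnIn (↑Qt : Set V) o t) := by
    rw [← prodBernoulli_restrW_real_biUnion_openConn (pinW Wt F₀ pat) (↑Qt : Set V) (Finset.mem_coe.2 (hSQ ho))]
    simp only [Finset.mem_coe]
  -- a connection from `o ∈ S` inside `Qt` is a link from `S`
  have h2 : (⋃ t ∈ (↑Rim : Set V), openConnIn (↑Qt : Set V) o t) ⊆ linkIn (↑Qt : Set V) S Rim := by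
    intro ω hω
    simp only [Set.mem_iUnion, exists_prop, Finset.mem_coe] at hω
    obtain ⟨t, ht, hot⟩ := hω
    exact mem_linkIn_iff.2 ⟨o, ho, t, ht, hot⟩
  -- wiring the source does not change the link probability; the rim is far from `c`
  have h3 : linkIn (↑Qt : Set V) S Rim ⊆ excess G c r₁ Qt S := by
    rw [excess]; exact linkIn_mono le_rfl le_rfl fun t ht => Finset.mem_filter.2 ⟨hRimQ ht, hfar t ht⟩
  calc (prodBernoulli (restrW (↑Qt : Set V) (pinW Wt F₀ pat))).real (⋃ t ∈ Rim, openConn o t)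
      = (prodBernoulli (pinW Wt F₀ pat)).real (⋃ t ∈ (↑Rim : Set V), openConnIn (↑Qt : Set V) o t) := h1
    _ ≤ (prodBernoulli (pinW Wt F₀ pat)).real (linkIn (↑Qt : Set V) S Rim) := measureReal_mono h2 (measure_ne_top _ _)
    _ = (prodBernoulli Wt).real (linkIn (↑Qt : Set V) S Rim) := (real_linkIn_eq_pinW_source Wt Qt hSR hF₀ pat).symm
    _ ≤ (prodBernoulli Wt).real (excess G c r₁ Qt S) := measureReal_mono h3 (measure_ne_top _ _)
    _ = (bondPercolation G q).real (excess G c r₁ Qt S) := Skel.real_excess_eq G hWQ' hQπ c r₁ S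
    _ ≤ η := hR₁ c r₁ hR Rw Qt S hQw hQm hSQ hnear

/-! ## §2 The discharge over the habitat-restricted window graph `winGraphIn G Ω` -/

/-- **Rim excess ≤ η in a habitat-restricted window graph** from an excess radius at the running parameter (the conclusion of
`Skelφ.exists_excess_radius hfr hC w₀ R₀' m hη` / `exists_excess_radius_uniform` at `q`), `R₁ ≤ R − L'`, the habitat `D ⊆ Ω` inside
`B_G(w₀, R_w)` and of planar diameter `≤ m` — the (C) chain's rim clause under the Ω-route (φ-level form of `Skel.real_rim_le_of_radius_In`;
the subbox hypothesis at the ambient `DecidableEq`). [cite: KozmaNitzan2024, §4 Lemma 12 (p. 24)] [cite: MartineauSevero2019, Cor. 2.2] -/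
theorem real_rim_le_of_radius_In [DecidableEq V] [Countable V] {Ω : Finset V} {Wt : Sym2 V → unitInterval} {q : unitInterval} {D : Finset V}
    (hWD : IsSubbox (winGraphIn G Ω) Wt q D) (hDΩ : D ⊆ Ω) (hWG : ∀ e, e ∉ G.edgeSet → Wt e = 0)
    {root : V} (hroot : root ∉ D) {w₀ : V} {R L' R₀' : ℕ} {Rim : Finset V} (hRimD : Rim ⊆ D)
    (hRimfar : ∀ t ∈ Rim, t ∉ graphBall G w₀ (R - L'))
    (hA : ∀ a b, a ∉ D → b ∈ D → G.Adj a b → Wt s(a, b) ≠ 0 → b ∈ graphBall G w₀ R₀')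
    {m : ℕ} {η : ℝ} {R₁ : ℕ}
    (hR₁ : ∀ R', R₁ ≤ R' → ∀ (Rw : ℕ) (D' A' : Finset V), (∀ d ∈ D', d ∈ graphBall G w₀ Rw) →
      (∀ d ∈ D', ∀ d' ∈ D', φ d - φ d' ∈ box 2 m) → A' ⊆ D' → (∀ a ∈ A', a ∈ graphBall G w₀ R₀') →
        (bondPercolation G q).real (excess G w₀ R' D' A') ≤ η)
    (hR : R₁ ≤ R - L') {Rw : ℕ} (hDw : ∀ d ∈ D, d ∈ graphBall G w₀ Rw) (hDm : ∀ d ∈ D, ∀ d' ∈ D, φ d - φ d' ∈ box 2 m) :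
    (prodBernoulli Wt).real (⋃ t ∈ Rim, openConn root t) ≤ η := by
  -- the Φ-free `Skel.real_rim_le_excess_In` is stated with the classical `DecidableEq`; bridge by subsingleton-ness of instances
  have hWD' : @KNLevels.IsSubbox V (fun a b => Classical.propDecidable (a = b)) (winGraphIn G Ω) _ Wt q D := by convert hWD
  refine (Skel.real_rim_le_excess_In G hWD' hDΩ hWG hroot hRimD hRimfar hA).trans ?_
  exact hR₁ _ hR Rw D _ hDw hDm (Finset.filter_subset _ _) fun a ha => (Finset.mem_filter.1 ha).2

end Skelφ

end Summit.CriticalPhenomena.PercolationContinuityZ3.Theorems.Transplant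

end
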